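import Mathlib
import Literature.Topology.FourManifolds.CorkPresentationHomotopySphere
import HarnessLib

/-!
# CorkDecompositionInvolutive

Topic `Literature/Topology/FourManifolds`. Named literature fact(s) relocated by the gate from `Summits/SmoothPoincare4/SmoothPoincare4/Theorems/WeylBudgetCorkRegluablePscStubCorkPresentation.lean`
(accept-time relocation of `[cite]`d propositions written inline in a Summits proposal; human ruling 2026-08-15).
Sources: AkbulutYasui2008, CurtisFreedmanHsiangStong1996, KirbyCorks1996, Matveyev1996.

* `Literature.Topology.FourManifolds.matveyev1996_involutiveDecomposition`
-/

namespace Literature.Topology.FourManifolds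

open scoped Manifold ContDiff Topology

/-- **The cork decomposition theorem with involution** (named fact; one-piece gluing form with the
exterior's instances exposed).  If `X₁`, `X₂` are h-cobordant simply connected closed smooth
4-manifolds, then there are a compact contractible smooth 4-manifold with boundary `C`, a compact
smooth 4-manifold with boundary `W` (both Hausdorff, second countable), boundary data `bC`, `bW`,
an INVOLUTION `τ` of `∂C` and a diffeomorphism `φ : ∂C ≅ ∂W` such that `X₁ = C ∪_φ W` and
`X₂ = C ∪_{φ ∘ τ} W` (`Literature.Topology.FourManifolds.IsBoundaryGluing`).  Printed: Kirby,
*Akbulut's corks and h-cobordisms of smooth simply connected 4-manifolds*, Turkish J. Math. 20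
(1996), p. 1, Theorem — "Let `M⁵` be a smooth 5-dimensional h-cobordism between two simply
connected, closed 4-manifolds, `M₀` and `M₁`. Then there exists a sub-h-cobordism `A⁵ ⊂ M⁵`
between `A₀ ⊂ M₀` and `A₁ ⊂ M₁` with the properties: (1) `A₀` and hence `A` and `A₁` are compact
contractible manifolds, and (2) `M - int A` is a product h-cobordism" — with Addendum (D): "`A₀`
is diffeomorphic to `A₁` by a diffeomorphism which, restricted to `∂A₀ = ∂A₁`, is an involution
[mat95]" (so `M₀ = A₀ ∪ (M₀ - int A₀)` and, identifying `M₁ - int A₁` with `M₀ - int A₀` and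
`∂A₁` with `∂A₀` through the product, `M₁ = A₀ ∪_τ (M₀ - int A₀)` for the boundary involution
`τ`); the decomposition is Matveyev, J. Differential Geom. 44 (1996), Theorem (parts 1–2:
"`M₁ = M ♯_Σ W₁`, `M₂ = M ♯_Σ W₂` … `W₁`, `W₂` smooth, compact, contractible … `W₁` is
diffeomorphic to `W₂`"), independently Curtis–Freedman–Hsiang–Stong 1996, Theorem, and the
involution is credited to Matveyev by Kirby (loc. cit.) and by Akbulut–Yasui 2008, Thm. 1.1
([M], [C], [AM2]): "one is obtained from the other by removing a contractible 4-manifold and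
gluing it via an involution on the boundary".  The Stein refinement (Akbulut–Matveyev 1998) and
the `H₂`-compatibility clause of Matveyev's part 1 are omitted, as in the tree's
`Literature.Topology.FourManifolds.corkDecomposition` / `Matveyev1996_decomposition` (which omit
the involution too).  Stated at universe `0`, the level of `HomotopySphere.carrier` and of
hypothesis `hT` of
`Literature.Barriers.SmoothPoincare4.akbulut1991_notExtendsToDiffeomorph_of_involutiveCorkTheorem`,
whose binder telescope this is verbatim.  Users take `(hT : matveyev1996_involutiveDecomposition)`.
[cite: KirbyCorks1996, Theorem and Addendum (D), p. 1 (arXiv:math/9712231)]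
[cite: Matveyev1996, Theorem (Introduction), parts 1–2]
[cite: AkbulutYasui2008, Thm. 1.1 (arXiv:0806.3010 numbering)]
[cite: CurtisFreedmanHsiangStong1996, Theorem]
[file Topology/FourManifolds/CorkDecompositionInvolutive] -/
def matveyev1996_involutiveDecomposition : Prop :=
  ∀ (X₁ X₂ : Type) [TopologicalSpace X₁] [T2Space X₁] [SecondCountableTopology X₁]
    [ChartedSpace (EuclideanSpace ℝ (Fin 4)) X₁] [IsManifold (𝓡 4) ∞ X₁] [CompactSpace X₁]
    [SimplyConnectedSpace X₁]
    [TopologicalSpace X₂] [T2Space X₂] [SecondCountableTopology X₂]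
    [ChartedSpace (EuclideanSpace ℝ (Fin 4)) X₂] [IsManifold (𝓡 4) ∞ X₂] [CompactSpace X₂]
    [SimplyConnectedSpace X₂],
    Literature.Topology.FourManifolds.IsHCobordant 4 X₁ X₂ →
    ∃ (C : Type) (_ : TopologicalSpace C) (_ : T2Space C) (_ : SecondCountableTopology C)
      (_ : ChartedSpace (EuclideanHalfSpace 4) C) (_ : IsManifold (𝓡∂ 4) ∞ C)
      (_ : CompactSpace C) (_ : ContractibleSpace C)
      (W : Type) (_ : TopologicalSpace W) (_ : T2Space W) (_ : SecondCountableTopology W)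
      (_ : ChartedSpace (EuclideanHalfSpace 4) W) (_ : IsManifold (𝓡∂ 4) ∞ W)
      (_ : CompactSpace W)
      (bC : Literature.Topology.FourManifolds.BoundaryData (𝓡∂ 4) C (𝓡 3))
      (bW : Literature.Topology.FourManifolds.BoundaryData (𝓡∂ 4) W (𝓡 3))
      (τ : bC.carrier ≃ₘ⟮𝓡 3, 𝓡 3⟯ bC.carrier) (φ : bC.carrier ≃ₘ⟮𝓡 3, 𝓡 3⟯ bW.carrier),
      Function.Involutive τ ∧
        Literature.Topology.FourManifolds.IsBoundaryGluing bC bW φ (𝓡 4) X₁ ∧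
          Literature.Topology.FourManifolds.IsBoundaryGluing bC bW (τ.trans φ) (𝓡 4) X₂

end Literature.Topology.FourManifolds
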